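import Summits.CriticalPhenomena.PercolationContinuityZ3.Theorems.Transplant.FKThreeApexOmegaHat
import HarnessLib

/-!
# The three-apex monoid: the semigroup theorem for `Ω_q` — layer 3a: symmetry, membership of the special points, the direct products

Helper file (`--supports stmt-CriticalPhenomena-4575`), FK sub-lane `prim-bschramm-fk-3` (gen 14); builds on p205010 (kernel theorem, internal audit
signed; external expert review pending).  Pure real algebra, no sorries; standard axioms.  Memo `bschramm/prim-bschramm-fk-3/DISJOINT-VIA-U.md` §2(iii)–(v), §7.

* `H5.swapXY` (the relabelling `b ↔ c`: `x̂ ↔ ŷ`) preserves `Ω_q` (and its weak version) and exchanges the two kinds of face points;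
* the special points lie in `Ω_q`: `bdPt_om` (curved boundary), `edgePt_om`, `diagPt_om`, `face1Pt_om`, `face2Pt_om`;
* copositivity of binary quadratic forms on the quadrant (`quad_nonneg`, `quad_copos_iff_aux`, `OmW.ja_or_det`); the basic conditions of a product
  (`nab_mul_nonneg`, `OmW.mul_of_U`, `OmW.mul_of_det`);
* the exact products `face1Pt·face1Pt = face1Pt`, `face2Pt·face2Pt = face2Pt`, `face1Pt = edgePt·diagPt`, `edgePt, diagPt ∈ T1` and — from the certified
  determinants of layer 2 — `Om (bdPt·bdPt)`, `Om (bdPt·edgePt)`, `Om (bdPt·diagPt)`, `Om (face1Pt·face2Pt)`;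
* the formal lower endpoint (`ẑ = 0`): its product with any weak member is a weak member (`OmW.mul_zeroPt`).
[folklore]
-/

noncomputable section

namespace Summit.CriticalPhenomena.PercolationContinuityZ3.Theorems

namespace FK

namespace ThreeApex

namespace H5

/-! ### The symmetry `x̂ ↔ ŷ` -/

/-- Swap `x̂ ↔ ŷ` (relabelling `b ↔ c`). [folklore] -/
def swapXY (h : H5) : H5 := ⟨h.u, h.y, h.x, h.z, h.v⟩

/-- `swapXY` is an involution. [folklore] -/
theorem swapXY_swapXY (h : H5) : swapXY (swapXY h) = h := rfl
/-- `swapXY` is multiplicative. [folklore] -/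
theorem swapXY_mul (a b : H5) : swapXY (mul a b) = mul (swapXY a) (swapXY b) := rfl
/-- `swapXY` commutes with block scalings. [folklore] -/
theorem swapXY_scale (l m : ℝ) (h : H5) : swapXY (scale l m h) = scale l m (swapXY h) := rfl

/-- `nab ∘ swapXY = nac`. [folklore] -/
theorem nab_swapXY (q : ℝ) (h : H5) : nab q (swapXY h) = nac q h := rfl
/-- `nac ∘ swapXY = nab`. [folklore] -/
theorem nac_swapXY (q : ℝ) (h : H5) : nac q (swapXY h) = nab q h := rfl
/-- `ja` is `swapXY`-invariant. [folklore] -/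
theorem ja_swapXY (h : H5) : ja (swapXY h) = ja h := by simp only [ja, swapXY]; ring
/-- `phi (swapXY h) w₁ w₂ = phi h w₂ w₁`. [folklore] -/
theorem phi_swapXY (q w₁ w₂ : ℝ) (h : H5) : phi q w₁ w₂ (swapXY h) = phi q w₂ w₁ h := by
  simp only [phi, nab_swapXY, nac_swapXY, ja_swapXY]; ring

/-- `Ω_q` is `swapXY`-invariant. [folklore] -/
theorem Om.swapXY {q : ℝ} {h : H5} (hh : Om q h) : Om q (H5.swapXY h) := by
  refine ⟨hh.u_pos, hh.z_pos, hh.y_ge, hh.x_ge, hh.syz, hh.sxz, ?_, ?_, fun w₁ w₂ hw₁ hw₂ => ?_⟩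
  · rw [nab_swapXY]; exact hh.nac
  · rw [nac_swapXY]; exact hh.nab
  · rw [phi_swapXY]; exact hh.U w₂ w₁ hw₂ hw₁

/-- Weak `Ω_q` is `swapXY`-invariant. [folklore] -/
theorem OmW.swapXY {q : ℝ} {h : H5} (hh : OmW q h) : OmW q (H5.swapXY h) := by
  refine ⟨hh.u_pos, hh.z_nn, hh.y_ge, hh.x_ge, hh.syz, hh.sxz, ?_, ?_, fun w₁ w₂ hw₁ hw₂ => ?_⟩
  · rw [nab_swapXY]; exact hh.nac
  · rw [nac_swapXY]; exact hh.nab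
  · rw [phi_swapXY]; exact hh.U w₂ w₁ hw₂ hw₁

/-- `swapXY` exchanges the two kinds of face points. [folklore] -/
theorem swapXY_face1Pt (b₁ a₁ : ℝ) : swapXY (face1Pt b₁ a₁) = face2Pt b₁ a₁ := rfl

/-! ### Membership of the special points -/

/-- Curved-boundary points lie in `Ω_q` (`0 ≤ q ≤ 1`, `0 < s ≤ 1`, `0 < t`). [folklore] -/
theorem bdPt_om {q s t : ℝ} (hq0 : 0 ≤ q) (hq1 : q ≤ 1) (hs0 : 0 < s) (hs1 : s ≤ 1) (ht : 0 < t) : Om q (bdPt q s t) := by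
  have hq' : 0 ≤ 1 - q := sub_nonneg.2 hq1
  have hp : 0 < 2 - q := by linarith
  have hs' : 0 ≤ 1 - s := sub_nonneg.2 hs1
  have hrs : 0 ≤ 1 - (1 - q) * s := by nlinarith
  have hD := bdD_pos hq1 hs0 ht.le
  have e1 : nab q (bdPt q s t) = t ^ 2 * ((2 - q) * (1 - s) * (1 - (1 - q) * s)) := by
    simp only [nab, bdPt, Big.bdD, Big.bdX, Big.bdY]; ring
  have e2 : nac q (bdPt q s t) = (2 - q) * (1 - s) * (1 - (1 - q) * s) := by
    simp only [nac, bdPt, Big.bdD, Big.bdX, Big.bdY]; ring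
  have e3 : ja (bdPt q s t) = -(2 * t * (1 - s) * (1 - (1 - q) * s)) := by
    simp only [ja, bdPt, Big.bdD, Big.bdX, Big.bdY]; ring
  refine Om.of_det (by simpa [bdPt] using hD) (by simpa [bdPt] using hs0) ?_ ?_ ?_ ?_ ?_ ?_ ?_
  · show Big.bdD q s t ≤ Big.bdX q s t
    have : Big.bdX q s t - Big.bdD q s t = t * (1 - s) * ((2 - q) * t + 2 * (1 - q)) := by
      simp only [Big.bdD, Big.bdX]; ring
    nlinarith [mul_nonneg (mul_nonneg ht.le hs') (by positivity : 0 ≤ (2 - q) * t + 2 * (1 - q))]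
  · show Big.bdD q s t ≤ Big.bdY q s t
    have : Big.bdY q s t - Big.bdD q s t = (1 - s) * ((2 - q) + 2 * (1 - q) * t) := by
      simp only [Big.bdD, Big.bdY]; ring
    nlinarith [mul_nonneg hs' (by positivity : 0 ≤ (2 - q) + 2 * (1 - q) * t)]
  · show Big.bdX q s t * s ≤ Big.bdD q s t * 1
    have : Big.bdD q s t * 1 - Big.bdX q s t * s = (1 - s) * (2 * t + (2 - q) * s) := by
      simp only [Big.bdD, Big.bdX]; ring
    nlinarith [mul_nonneg hs' (by positivity : 0 ≤ 2 * t + (2 - q) * s)]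
  · show Big.bdY q s t * s ≤ Big.bdD q s t * 1
    have : Big.bdD q s t * 1 - Big.bdY q s t * s = t * (1 - s) * ((2 - q) * s * t + 2) := by
      simp only [Big.bdD, Big.bdY]; ring
    nlinarith [mul_nonneg (mul_nonneg ht.le hs') (by positivity : 0 ≤ (2 - q) * s * t + 2)]
  · rw [e1]; positivity
  · rw [e2]; positivity
  · rw [e1, e2, e3]; nlinarith [sq_nonneg (t * (1 - s) * (1 - (1 - q) * s)), hp.le]

/-- ab-edge-ray points lie in `Ω_q` (`0 ≤ q ≤ 1`, `e ≥ 0`). [folklore] -/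
theorem edgePt_om {q e : ℝ} (hq0 : 0 ≤ q) (he : 0 ≤ e) : Om q (edgePt e) := by
  have e1 : nab q (edgePt e) = e * (e + q) := by simp only [nab, edgePt]; ring
  have e2 : nac q (edgePt e) = 0 := by simp only [nac, edgePt]; ring
  have e3 : ja (edgePt e) = 0 := by simp only [ja, edgePt]; ring
  refine Om.of_det ?_ ?_ ?_ ?_ ?_ ?_ ?_ ?_ ?_
  · show (0:ℝ) < 1; norm_num
  · show (0:ℝ) < 1; norm_num
  · show (1:ℝ) ≤ 1 + e; linarith
  · show (1:ℝ) ≤ 1; norm_num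
  · show (1 + e) * 1 ≤ 1 * (1 + e); linarith
  · show (1:ℝ) * 1 ≤ 1 * (1 + e); linarith
  · rw [e1]; positivity
  · rw [e2]
  · rw [e1, e2, e3]; simp

/-- Diagonal points lie in `Ω_q` (`q ≤ 1`, `b ≥ 0`). [folklore] -/
theorem diagPt_om {q b : ℝ} (hq1 : q ≤ 1) (hb : 0 ≤ b) : Om q (diagPt b) := by
  have hp : 0 ≤ 2 - q := by linarith
  have e1 : nab q (diagPt b) = b * (b + 1) := by simp only [nab, diagPt]; ring
  have e2 : nac q (diagPt b) = b * (b + 1) := by simp only [nac, diagPt]; ring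
  have e3 : ja (diagPt b) = b := by simp only [ja, diagPt]; ring
  refine ⟨?_, ?_, ?_, ?_, ?_, ?_, ?_, ?_, fun w₁ w₂ hw₁ hw₂ => ?_⟩
  · show (0:ℝ) < 1; norm_num
  · show (0:ℝ) < 1; norm_num
  · show (1:ℝ) ≤ 1 + b; linarith
  · show (1:ℝ) ≤ 1 + b; linarith
  · show (1 + b) * 1 ≤ 1 * (1 + b); linarith
  · show (1 + b) * 1 ≤ 1 * (1 + b); linarith
  · rw [e1]; positivity
  · rw [e2]; positivity
  · rw [phi, e1, e2, e3]
    have : 0 ≤ w₁ * w₂ * ((2 - q) * b) := by positivity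
    positivity

/-- `T1`-face points lie in `Ω_q` (`0 ≤ q ≤ 1`, `b₁, a₁ ≥ 0`). [folklore] -/
theorem face1Pt_om {q b₁ a₁ : ℝ} (hq0 : 0 ≤ q) (hq1 : q ≤ 1) (h1 : 0 ≤ b₁) (h2 : 0 ≤ a₁) : Om q (face1Pt b₁ a₁) := by
  have hq' : 0 ≤ 1 - q := sub_nonneg.2 hq1
  have hp : 0 ≤ 2 - q := by linarith
  have e1 : nab q (face1Pt b₁ a₁) = (b₁ + a₁) * (b₁ + a₁ + q) + (1 - q) * b₁ := by
    simp only [nab, face1Pt]; ring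
  have e2 : nac q (face1Pt b₁ a₁) = (1 + b₁ + a₁) * b₁ := by simp only [nac, face1Pt]; ring
  have e3 : ja (face1Pt b₁ a₁) = b₁ := by simp only [ja, face1Pt]; ring
  refine ⟨?_, ?_, ?_, ?_, ?_, ?_, ?_, ?_, fun w₁ w₂ hw₁ hw₂ => ?_⟩
  · show (0:ℝ) < 1; norm_num
  · show (0:ℝ) < 1; norm_num
  · show (1:ℝ) ≤ 1 + b₁ + a₁; linarith
  · show (1:ℝ) ≤ 1 + b₁; linarith
  · show (1 + b₁ + a₁) * 1 ≤ 1 * (1 + b₁ + a₁); linarith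
  · show (1 + b₁) * 1 ≤ 1 * (1 + b₁ + a₁); linarith
  · rw [e1]; positivity
  · rw [e2]; positivity
  · rw [phi, e1, e2, e3]
    have : 0 ≤ w₁ * w₂ * ((2 - q) * b₁) := by positivity
    positivity

/-- `T2`-face points lie in `Ω_q`. [folklore] -/
theorem face2Pt_om {q b₂ a₂ : ℝ} (hq0 : 0 ≤ q) (hq1 : q ≤ 1) (h1 : 0 ≤ b₂) (h2 : 0 ≤ a₂) : Om q (face2Pt b₂ a₂) := by
  rw [← swapXY_face1Pt]; exact (face1Pt_om hq0 hq1 h1 h2).swapXY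
/-! ### Copositivity of a binary quadratic form on the quadrant -/

/-- `α,β ≥ 0`, `γ² ≤ 4αβ` ⟹ `w₁²α + w₂²β + w₁w₂γ ≥ 0` for all real `w`. [folklore] -/
theorem quad_nonneg {α β γ : ℝ} (ha : 0 ≤ α) (hb : 0 ≤ β) (hd : γ ^ 2 ≤ 4 * α * β) (w₁ w₂ : ℝ) :
    0 ≤ w₁ ^ 2 * α + w₂ ^ 2 * β + w₁ * w₂ * γ := by
  have hP : 0 ≤ w₁ ^ 2 * α + w₂ ^ 2 * β := by positivity
  have hsq : (w₁ * w₂ * γ) ^ 2 ≤ (w₁ ^ 2 * α + w₂ ^ 2 * β) ^ 2 := by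
    have e : (w₁ ^ 2 * α + w₂ ^ 2 * β) ^ 2 = (w₁ ^ 2 * α - w₂ ^ 2 * β) ^ 2 + w₁ ^ 2 * w₂ ^ 2 * (4 * α * β) := by ring
    have e2 : (w₁ * w₂ * γ) ^ 2 = w₁ ^ 2 * w₂ ^ 2 * γ ^ 2 := by ring
    rw [e, e2]
    have : w₁ ^ 2 * w₂ ^ 2 * γ ^ 2 ≤ w₁ ^ 2 * w₂ ^ 2 * (4 * α * β) := mul_le_mul_of_nonneg_left hd (by positivity)
    nlinarith [sq_nonneg (w₁ ^ 2 * α - w₂ ^ 2 * β)]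
  nlinarith [(abs_le_of_sq_le_sq' hsq hP).1]

/-- Converse: copositivity on the quadrant gives `α,β ≥ 0` and `γ ≥ 0 ∨ γ² ≤ 4αβ`. [folklore] -/
theorem quad_copos_iff_aux {α β γ : ℝ} (H : ∀ w₁ w₂ : ℝ, 0 ≤ w₁ → 0 ≤ w₂ → 0 ≤ w₁ ^ 2 * α + w₂ ^ 2 * β + w₁ * w₂ * γ) :
    0 ≤ α ∧ 0 ≤ β ∧ (0 ≤ γ ∨ γ ^ 2 ≤ 4 * α * β) := by
  have ha : 0 ≤ α := by simpa using H 1 0 zero_le_one le_rfl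
  have hb : 0 ≤ β := by simpa using H 0 1 le_rfl zero_le_one
  refine ⟨ha, hb, ?_⟩
  by_cases hγ : 0 ≤ γ
  · exact Or.inl hγ
  right
  have hγ' : γ < 0 := lt_of_not_ge hγ
  have hα : 0 < α := by
    rcases ha.lt_or_eq with h | h
    · exact h
    · exfalso
      have hng : 0 < -γ := by linarith
      have hw : 0 ≤ (β + 1) / -γ := by positivity
      have := H ((β + 1) / -γ) 1 hw zero_le_one
      rw [← h] at this
      have hγ0 : γ ≠ 0 := hγ'.ne
      have e : ((β + 1) / -γ) * 1 * γ = -(β + 1) := by field_simp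
      rw [e] at this
      nlinarith
  have key := H (-γ) (2 * α) (by linarith) (by linarith)
  have e : (-γ) ^ 2 * α + (2 * α) ^ 2 * β + (-γ) * (2 * α) * γ = α * (4 * α * β - γ ^ 2) := by ring
  rw [e] at key
  by_contra hlt
  have : α * (4 * α * β - γ ^ 2) < 0 := mul_neg_of_pos_of_neg hα (by linarith [lt_of_not_ge hlt])
  linarith

/-- For a weak member (`q ≤ 1`): `J_a ≥ 0` or the determinant inequality. [folklore] -/
theorem OmW.ja_or_det {q : ℝ} {h : H5} (hq1 : q ≤ 1) (hh : OmW q h) :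
    0 ≤ H5.ja h ∨ ((2 - q) * H5.ja h) ^ 2 ≤ 4 * H5.nab q h * H5.nac q h := by
  rcases (quad_copos_iff_aux (fun w₁ w₂ hw₁ hw₂ => by simpa [H5.phi] using hh.U w₁ w₂ hw₁ hw₂)).2.2 with h1 | h1
  · left
    have hp : 0 < 2 - q := by linarith
    by_contra hc
    exact absurd h1 (not_le.2 (mul_neg_of_pos_of_neg hp (lt_of_not_ge hc)))
  · exact Or.inr h1
/-! ### Basic conditions of a product -/

/-- `N^{(ab)}` of a product is nonnegative. [folklore] -/
theorem nab_mul_nonneg {q : ℝ} (hq1 : q ≤ 1) {a b : H5} (ha : OmW q a) (hav : 0 < a.v) (hb : OmW q b) (hbv : 0 < b.v) :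
    0 ≤ nab q (mul a b) := by
  have hr : 0 ≤ 1 - q := sub_nonneg.2 hq1
  have hp : 0 ≤ 2 - q := by linarith
  have e : nab q (mul a b) = nab q a * (b.x * b.v)
      + ((2 - q) * (a.u * a.v) - (1 - q) * (a.y * a.z)) * nab q b
      + (2 - q) * (1 - q) * (a.u * a.v - a.y * a.z) * (b.u * b.v - b.y * b.z) := by
    simp only [nab, mul]; ring
  rw [e]
  have h1 : 0 ≤ (2 - q) * (a.u * a.v) - (1 - q) * (a.y * a.z) := by
    nlinarith [ha.syz, mul_pos ha.u_pos hav, mul_nonneg (le_trans ha.u_pos.le ha.y_ge) ha.z_nn]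
  have h2 : 0 ≤ a.u * a.v - a.y * a.z := sub_nonneg.2 ha.syz
  have h3 : 0 ≤ b.u * b.v - b.y * b.z := sub_nonneg.2 hb.syz
  have h4 : 0 ≤ b.x * b.v := mul_nonneg (le_trans hb.u_pos.le hb.x_ge) hbv.le
  have := ha.nab; have := hb.nab
  positivity

/-- `N^{(ac)}` of a product is nonnegative. [folklore] -/
theorem nac_mul_nonneg {q : ℝ} (hq1 : q ≤ 1) {a b : H5} (ha : OmW q a) (hav : 0 < a.v) (hb : OmW q b) (hbv : 0 < b.v) :
    0 ≤ nac q (mul a b) := by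
  have := nab_mul_nonneg hq1 ha.swapXY hav hb.swapXY hbv
  rwa [← swapXY_mul, nab_swapXY] at this

/-- A product of weak members satisfying `(U_a)` is a weak member. [folklore] -/
theorem OmW.mul_of_U {q : ℝ} (hq1 : q ≤ 1) {a b : H5} (ha : OmW q a) (hav : 0 < a.v) (hb : OmW q b) (hbv : 0 < b.v)
    (hU : ∀ w₁ w₂ : ℝ, 0 ≤ w₁ → 0 ≤ w₂ → 0 ≤ phi q w₁ w₂ (mul a b)) : OmW q (mul a b) := by
  have hax : 0 ≤ a.x := le_trans ha.u_pos.le ha.x_ge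
  have hay : 0 ≤ a.y := le_trans ha.u_pos.le ha.y_ge
  refine ⟨mul_pos ha.u_pos hb.u_pos, mul_nonneg ha.z_nn hb.z_nn, ?_, ?_, ?_, ?_, nab_mul_nonneg hq1 ha hav hb hbv,
    nac_mul_nonneg hq1 ha hav hb hbv, hU⟩
  · show a.u * b.u ≤ a.x * b.x
    exact mul_le_mul ha.x_ge hb.x_ge hb.u_pos.le hax
  · show a.u * b.u ≤ a.y * b.y
    exact mul_le_mul ha.y_ge hb.y_ge hb.u_pos.le hay
  · show a.x * b.x * (a.z * b.z) ≤ a.u * b.u * (a.v * b.v)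
    have e1 := ha.sxz; have e2 := hb.sxz
    calc a.x * b.x * (a.z * b.z) = (a.x * a.z) * (b.x * b.z) := by ring
      _ ≤ (a.u * a.v) * (b.u * b.v) :=
          mul_le_mul e1 e2 (mul_nonneg (le_trans hb.u_pos.le hb.x_ge) hb.z_nn) (mul_nonneg ha.u_pos.le hav.le)
      _ = a.u * b.u * (a.v * b.v) := by ring
  · show a.y * b.y * (a.z * b.z) ≤ a.u * b.u * (a.v * b.v)
    have e1 := ha.syz; have e2 := hb.syz
    calc a.y * b.y * (a.z * b.z) = (a.y * a.z) * (b.y * b.z) := by ring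
      _ ≤ (a.u * a.v) * (b.u * b.v) :=
          mul_le_mul e1 e2 (mul_nonneg (le_trans hb.u_pos.le hb.y_ge) hb.z_nn) (mul_nonneg ha.u_pos.le hav.le)
      _ = a.u * b.u * (a.v * b.v) := by ring

/-- A product of weak members whose determinant inequality holds is a weak member. [folklore] -/
theorem OmW.mul_of_det {q : ℝ} (hq1 : q ≤ 1) {a b : H5} (ha : OmW q a) (hav : 0 < a.v) (hb : OmW q b) (hbv : 0 < b.v)
    (hdet : ((2 - q) * ja (mul a b)) ^ 2 ≤ 4 * H5.nab q (mul a b) * H5.nac q (mul a b)) : OmW q (mul a b) :=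
  OmW.mul_of_U hq1 ha hav hb hbv fun w₁ w₂ _ _ =>
    quad_nonneg (nab_mul_nonneg hq1 ha hav hb hbv) (nac_mul_nonneg hq1 ha hav hb hbv) hdet w₁ w₂
/-! ### Exact products of face points -/

/-- `T1 · T1 ⊆ T1` (exactly). [folklore] -/
theorem mul_face1Pt_face1Pt (b₁ a₁ b₁' a₁' : ℝ) :
    mul (face1Pt b₁ a₁) (face1Pt b₁' a₁') = face1Pt (b₁ + b₁' + b₁ * b₁') (a₁ * (1 + b₁' + a₁') + (1 + b₁) * a₁') := by
  apply H5.ext <;> simp only [mul, face1Pt] <;> ring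

/-- `T2 · T2 ⊆ T2` (exactly). [folklore] -/
theorem mul_face2Pt_face2Pt (b₂ a₂ b₂' a₂' : ℝ) :
    mul (face2Pt b₂ a₂) (face2Pt b₂' a₂') = face2Pt (b₂ + b₂' + b₂ * b₂') (a₂ * (1 + b₂' + a₂') + (1 + b₂) * a₂') := by
  apply H5.ext <;> simp only [mul, face2Pt] <;> ring

/-- The ab-edge ray lies in the face `T1`: `edgePt e = face1Pt 0 e`. [folklore] -/
theorem edgePt_eq_face1Pt (e : ℝ) : edgePt e = face1Pt 0 e := by simp only [edgePt, face1Pt, add_zero]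
/-- The diagonal lies in the face `T1`: `diagPt b = face1Pt b 0`. [folklore] -/
theorem diagPt_eq_face1Pt (b : ℝ) : diagPt b = face1Pt b 0 := by simp only [diagPt, face1Pt, add_zero]
/-- The diagonal lies in the face `T2`: `diagPt b = face2Pt b 0`. [folklore] -/
theorem diagPt_eq_face2Pt (b : ℝ) : diagPt b = face2Pt b 0 := by simp only [diagPt, face2Pt, add_zero]

/-- A `T1` point is (edge ray) · (diagonal): `face1Pt b₁ a₁ = edgePt (a₁/(1+b₁)) · diagPt b₁` (`1 + b₁ ≠ 0`). [folklore] -/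
theorem face1Pt_eq_mul {b₁ : ℝ} (a₁ : ℝ) (hb : 1 + b₁ ≠ 0) : face1Pt b₁ a₁ = mul (edgePt (a₁ / (1 + b₁))) (diagPt b₁) := by
  apply H5.ext <;> simp only [mul, edgePt, diagPt, face1Pt] <;> field_simp

/-! ### Certified products are members -/

/-- `T1 · T1 ∈ Ω_q`. [folklore] -/
theorem om_face1_mul_face1 {q b₁ a₁ b₁' a₁' : ℝ} (hq0 : 0 ≤ q) (hq1 : q ≤ 1) (h1 : 0 ≤ b₁) (h2 : 0 ≤ a₁) (h3 : 0 ≤ b₁') (h4 : 0 ≤ a₁') :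
    Om q (mul (face1Pt b₁ a₁) (face1Pt b₁' a₁')) := by
  rw [mul_face1Pt_face1Pt]; exact face1Pt_om hq0 hq1 (by positivity) (by positivity)

/-- `T2 · T2 ∈ Ω_q`. [folklore] -/
theorem om_face2_mul_face2 {q b₂ a₂ b₂' a₂' : ℝ} (hq0 : 0 ≤ q) (hq1 : q ≤ 1) (h1 : 0 ≤ b₂) (h2 : 0 ≤ a₂) (h3 : 0 ≤ b₂') (h4 : 0 ≤ a₂') :
    Om q (mul (face2Pt b₂ a₂) (face2Pt b₂' a₂')) := by
  rw [mul_face2Pt_face2Pt]; exact face2Pt_om hq0 hq1 (by positivity) (by positivity)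

/-- `T1 · T2 ∈ Ω_q` (certificate `pieceFace`). [folklore] -/
theorem om_face1_mul_face2 {q b₁ a₁ b₂ a₂ : ℝ} (hq0 : 0 ≤ q) (hq1 : q ≤ 1) (h1 : 0 ≤ b₁) (h2 : 0 ≤ a₁) (h3 : 0 ≤ b₂) (h4 : 0 ≤ a₂) :
    Om q (mul (face1Pt b₁ a₁) (face2Pt b₂ a₂)) :=
  (OmW.mul_of_det hq1 (face1Pt_om hq0 hq1 h1 h2).toW (by simp only [face1Pt]; positivity) (face2Pt_om hq0 hq1 h3 h4).toW
    (by simp only [face2Pt]; positivity) (det_face_mul_face hq0 hq1 h1 h2 h3 h4)).toOm (by simp [mul, face1Pt, face2Pt])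

/-- `C · C ∈ Ω_q` (certificate `BIG`). [folklore] -/
theorem om_bd_mul_bd {q s s₂ t t₂ : ℝ} (hq0 : 0 ≤ q) (hq1 : q ≤ 1) (hs0 : 0 < s) (hs1 : s ≤ 1) (hr0 : 0 < s₂) (hr1 : s₂ ≤ 1)
    (ht : 0 < t) (ht₂ : 0 < t₂) : Om q (mul (bdPt q s t) (bdPt q s₂ t₂)) :=
  (OmW.mul_of_det hq1 (bdPt_om hq0 hq1 hs0 hs1 ht).toW (by simp [bdPt]) (bdPt_om hq0 hq1 hr0 hr1 ht₂).toW (by simp [bdPt])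
    (det_bd_mul_bd hq0 hq1 hs0.le hs1 hr0.le hr1 ht.le ht₂.le)).toOm (by simp only [mul, bdPt]; positivity)

/-- `C · (ab-edge ray) ∈ Ω_q` (certificate `pieceEdge`). [folklore] -/
theorem om_bd_mul_edge {q s t e : ℝ} (hq0 : 0 ≤ q) (hq1 : q ≤ 1) (hs0 : 0 < s) (hs1 : s ≤ 1) (ht : 0 < t) (he : 0 ≤ e) :
    Om q (mul (bdPt q s t) (edgePt e)) :=
  (OmW.mul_of_det hq1 (bdPt_om hq0 hq1 hs0 hs1 ht).toW (by simp [bdPt]) (edgePt_om hq0 he).toW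
    (by simp only [edgePt]; positivity) (det_bd_mul_edge hq0 hq1 hs0.le hs1 ht.le he)).toOm (by simp only [mul, bdPt, edgePt]; positivity)

/-- `C · Δ ∈ Ω_q` (certificate `pieceDiag`). [folklore] -/
theorem om_bd_mul_diag {q s t b : ℝ} (hq0 : 0 ≤ q) (hq1 : q ≤ 1) (hs0 : 0 < s) (hs1 : s ≤ 1) (ht : 0 < t) (hb : 0 ≤ b) :
    Om q (mul (bdPt q s t) (diagPt b)) :=
  (OmW.mul_of_det hq1 (bdPt_om hq0 hq1 hs0 hs1 ht).toW (by simp [bdPt]) (diagPt_om hq1 hb).toW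
    (by simp only [diagPt]; positivity) (det_bd_mul_diag hq0 hq1 hs0.le hs1 ht.le hb)).toOm (by simp only [mul, bdPt, diagPt]; positivity)

/-! ### The formal lower endpoint `ẑ = 0` -/

/-- A weak member with `ẑ = 0` times any weak member is a weak member. [folklore] -/
theorem OmW.zero_mul {q : ℝ} (hq1 : q ≤ 1) {p b : H5} (hp : OmW q p) (hpz : p.z = 0) (hpv : 0 < p.v) (hb : OmW q b)
    (hbv : 0 < b.v) : OmW q (mul p b) := by
  have hP : 0 ≤ 2 - q := by linarith
  -- the data of `p`
  have hn1 : 0 ≤ p.x - (2 - q) * p.u := by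
    have e : H5.nab q p = p.v * (p.x - (2 - q) * p.u) := by rw [H5.nab, hpz]; ring
    have := hp.nab; rw [e] at this
    by_contra hc; exact absurd this (not_le.2 (mul_neg_of_pos_of_neg hpv (lt_of_not_ge hc)))
  have hn2 : 0 ≤ p.y - (2 - q) * p.u := by
    have e : H5.nac q p = p.v * (p.y - (2 - q) * p.u) := by rw [H5.nac, hpz]; ring
    have := hp.nac; rw [e] at this
    by_contra hc; exact absurd this (not_le.2 (mul_neg_of_pos_of_neg hpv (lt_of_not_ge hc)))
  have hdet0 : ((2 - q) * p.u) ^ 2 ≤ 4 * (p.x - (2 - q) * p.u) * (p.y - (2 - q) * p.u) := by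
    rcases hp.ja_or_det hq1 with h | h
    · have e : ja p = -(p.u * p.v) := by rw [ja, hpz]; ring
      rw [e] at h; nlinarith [mul_pos hp.u_pos hpv]
    · have e1 : H5.nab q p = p.v * (p.x - (2 - q) * p.u) := by rw [H5.nab, hpz]; ring
      have e2 : H5.nac q p = p.v * (p.y - (2 - q) * p.u) := by rw [H5.nac, hpz]; ring
      have e3 : ja p = -(p.u * p.v) := by rw [ja, hpz]; ring
      rw [e1, e2, e3] at h
      have hv2 : 0 < p.v ^ 2 := by positivity
      have : p.v ^ 2 * ((2 - q) * p.u) ^ 2 ≤ p.v ^ 2 * (4 * (p.x - (2 - q) * p.u) * (p.y - (2 - q) * p.u)) := by nlinarith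
      exact le_of_mul_le_mul_left this hv2
  -- the product
  have hbx : 0 ≤ b.x := le_trans hb.u_pos.le hb.x_ge
  have hby : 0 ≤ b.y := le_trans hb.u_pos.le hb.y_ge
  have hpx : 0 ≤ p.x := by nlinarith [hp.u_pos]
  have hpy : 0 ≤ p.y := by nlinarith [hp.u_pos]
  have hX : b.u * (p.x - (2 - q) * p.u) ≤ p.x * b.x - (2 - q) * (p.u * b.u) := by nlinarith [mul_le_mul_of_nonneg_left hb.x_ge hpx]
  have hY : b.u * (p.y - (2 - q) * p.u) ≤ p.y * b.y - (2 - q) * (p.u * b.u) := by nlinarith [mul_le_mul_of_nonneg_left hb.y_ge hpy]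
  have hX0 : 0 ≤ b.u * (p.x - (2 - q) * p.u) := mul_nonneg hb.u_pos.le hn1
  have hY0 : 0 ≤ b.u * (p.y - (2 - q) * p.u) := mul_nonneg hb.u_pos.le hn2
  have hdet : ((2 - q) * (p.u * b.u)) ^ 2 ≤ 4 * (p.x * b.x - (2 - q) * (p.u * b.u)) * (p.y * b.y - (2 - q) * (p.u * b.u)) := by
    have : ((2 - q) * (p.u * b.u)) ^ 2 = b.u ^ 2 * ((2 - q) * p.u) ^ 2 := by ring
    rw [this]
    calc b.u ^ 2 * ((2 - q) * p.u) ^ 2 ≤ b.u ^ 2 * (4 * (p.x - (2 - q) * p.u) * (p.y - (2 - q) * p.u)) :=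
          mul_le_mul_of_nonneg_left hdet0 (sq_nonneg _)
      _ = 4 * (b.u * (p.x - (2 - q) * p.u)) * (b.u * (p.y - (2 - q) * p.u)) := by ring
      _ ≤ 4 * (p.x * b.x - (2 - q) * (p.u * b.u)) * (p.y * b.y - (2 - q) * (p.u * b.u)) := by
          apply mul_le_mul (mul_le_mul_of_nonneg_left hX (by norm_num)) hY hY0 (by nlinarith [le_trans hX0 hX])
  have hV : 0 < p.v * b.v := mul_pos hpv hbv
  have e1 : H5.nab q (mul p b) = (p.v * b.v) * (p.x * b.x - (2 - q) * (p.u * b.u)) := by simp only [H5.nab, mul, hpz]; ring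
  have e2 : H5.nac q (mul p b) = (p.v * b.v) * (p.y * b.y - (2 - q) * (p.u * b.u)) := by simp only [H5.nac, mul, hpz]; ring
  have e3 : ja (mul p b) = -((p.u * b.u) * (p.v * b.v)) := by simp only [ja, mul, hpz]; ring
  refine ⟨mul_pos hp.u_pos hb.u_pos, by simp [mul, hpz], mul_le_mul hp.x_ge hb.x_ge hb.u_pos.le hpx,
    mul_le_mul hp.y_ge hb.y_ge hb.u_pos.le hpy, ?_, ?_, ?_, ?_, fun w₁ w₂ _ _ => ?_⟩
  · show p.x * b.x * (p.z * b.z) ≤ p.u * b.u * (p.v * b.v)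
    rw [hpz]; have := mul_pos (mul_pos hp.u_pos hb.u_pos) hV; nlinarith
  · show p.y * b.y * (p.z * b.z) ≤ p.u * b.u * (p.v * b.v)
    rw [hpz]; have := mul_pos (mul_pos hp.u_pos hb.u_pos) hV; nlinarith
  · rw [e1]; exact mul_nonneg hV.le (le_trans hX0 hX)
  · rw [e2]; exact mul_nonneg hV.le (le_trans hY0 hY)
  · rw [phi, e1, e2, e3]
    have key := quad_nonneg (le_trans hX0 hX) (le_trans hY0 hY) hdet w₁ (-w₂)
    have e : w₁ ^ 2 * (p.v * b.v * (p.x * b.x - (2 - q) * (p.u * b.u))) + w₂ ^ 2 * (p.v * b.v * (p.y * b.y - (2 - q) * (p.u * b.u))) +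
        w₁ * w₂ * ((2 - q) * -(p.u * b.u * (p.v * b.v))) =
        (p.v * b.v) * (w₁ ^ 2 * (p.x * b.x - (2 - q) * (p.u * b.u)) + (-w₂) ^ 2 * (p.y * b.y - (2 - q) * (p.u * b.u)) +
          w₁ * -w₂ * ((2 - q) * (p.u * b.u))) := by ring
    rw [e]; exact mul_nonneg hV.le key

end H5

end ThreeApex

end FK

end Summit.CriticalPhenomena.PercolationContinuityZ3.Theorems
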